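import Literature.Geometry.Riemannian.SphericalCylinderEntropy
import HarnessLib

/-!
# The typed zonal heat-kernel series of `S⁴` at ALL positive scales

Topic `Literature/Geometry/Riemannian`; continuation of `SphericalCylinderEntropy.lean`, whose
summability results for the typed Gegenbauer series
`𝔥(τ, s) = ∑_k e^{-k(k+3)τ} (2k+3)/3 · C_k^{(3/2)}(s)` (`zonal`, terms `wt k τ * gegen k s`) cover only
the large scales `τ ≥ 1` (there the crude bound `|C_k^{(3/2)}(s)| ≤ (k+1)(k+1)! 2^k` is beaten by
`e^{-k(k+3)τ}` uniformly).  Hamilton's monotonicity formula for the typed density of route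
`SmoothPoincare4/CylinderEntropy` (crux `CylinderRungTwo`, stub `stub_hamiltonMonotonicity`) and every
small-scale use of the kernel need the series at ALL `τ > 0`.  Proved here (everything; no facts):

* `abs_gegenTerm_le`, `abs_gegen_le_sq_mul_four_pow` — the EXPONENTIAL bound
  `|C_k^{(3/2)}(s)| ≤ (k+1)² 4^k` for `|s| ≤ 1`, from the explicit sum (DLMF 18.5.10):
  `(3/2)_{k-l} / (l! (k-2l)!) ≤ (k-l+1)!/(l!(k-2l)!) = (k-l+1) · binom(k-l, l) ≤ (k+1) 2^k` and
  `|2s|^{k-2l} ≤ 2^k`;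
* `abs_term_le_exp_mul_pow` — `|wt k τ · C_k(s)| ≤ e^{-k(k+3)τ} 32^k` (`(2k+3)/3 · (k+1)² ≤ 8^k`);
* `summable_majorant` — `∑_k e^{-k(k+3)τ} 32^k < ∞` for every `τ > 0` (eventually `≤ 2^{-k}`: once
  `k ≥ 63/τ`, `e^{(k+3)τ} ≥ (k+3)τ + 1 ≥ 64`);
* `summable_term_of_pos` — **the typed series is absolutely summable for every `τ > 0`, `|s| ≤ 1`**;
  `abs_zonal_le_majorant` — `|𝔥(τ, s)| ≤ ∑_k e^{-k(k+3)τ} 32^k`, a bound uniform in `s` and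
  non-increasing in `τ` (`majorant_antitone`), whence `abs_cylKernel_le_majorant`: the typed kernel is
  bounded on `N × N` at every fixed scale `τ > 0`, uniformly on `[τ₀, ∞)`;
* `continuousOn_term`, `continuousOn_zonal_prod_of_pos`, `continuousOn_zonal_prod` — `(τ, s) ↦ 𝔥(τ, s)`
  is jointly continuous on `(0, ∞) × [-1, 1]` (uniform convergence on `[τ₀, ∞) × [-1, 1]`).

## References
* NIST DLMF §18.5.10 (explicit sum for `C_n^{(λ)}`).
* R. S. Hamilton, *Monotonicity formulas for parabolic flows on manifolds*, Comm. Anal. Geom. 1 (1993),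
  127–137 (the density these series type).
-/

noncomputable section

open scoped BigOperators Topology
open Filter Set Finset

namespace Literature.Geometry.Riemannian.SphericalCylinderEntropy

/-! ### An exponential bound for the typed Gegenbauer polynomials -/

/-- **Term bound inside the explicit sum**: for `2l ≤ k` and `|s| ≤ 1`, the `l`-th summand of
`C_k^{(3/2)}(s)` is at most `(k+1) 4^k` in absolute value
(`(3/2)_{k-l} ≤ (k-l+1)! = (k-l+1) · binom(k-l,l) · l! (k-2l)!`, `binom ≤ 2^k`, `|2s|^{k-2l} ≤ 2^k`).
[folklore] -/
theorem abs_gegenTerm_le (k l : ℕ) (hl : 2 * l ≤ k) {s : ℝ} (hs : |s| ≤ 1) :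
    |(-1 : ℝ) ^ l * (∏ j ∈ Finset.range (k - l), ((3 : ℝ) / 2 + (j : ℝ))) /
        (((l.factorial : ℕ) : ℝ) * (((k - 2 * l).factorial : ℕ) : ℝ)) * (2 * s) ^ (k - 2 * l)|
      ≤ ((k : ℝ) + 1) * 4 ^ k := by
  have hden_pos : (0 : ℝ) < ((l.factorial : ℕ) : ℝ) * (((k - 2 * l).factorial : ℕ) : ℝ) := by
    positivity
  rw [abs_mul, abs_div, abs_mul, abs_pow, abs_neg, abs_one, one_pow, one_mul,
    abs_of_nonneg (prod_threeHalves_nonneg _), abs_pow, abs_of_pos hden_pos]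
  have hP : (∏ j ∈ Finset.range (k - l), ((3 : ℝ) / 2 + (j : ℝ))) ≤ ((k - l + 1).factorial : ℝ) :=
    prod_threeHalves_le _
  have hfact : ((k - l + 1).factorial : ℝ) = ((k - l + 1 : ℕ) : ℝ) * ((k - l).choose l : ℝ) *
      (((l.factorial : ℕ) : ℝ) * (((k - 2 * l).factorial : ℕ) : ℝ)) := by
    have h := Nat.choose_mul_factorial_mul_factorial (show l ≤ k - l by omega)
    have h2 : k - l - l = k - 2 * l := by omega
    rw [h2] at h
    rw [Nat.factorial_succ, ← h]
    push_cast
    ring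
  have hquot : (∏ j ∈ Finset.range (k - l), ((3 : ℝ) / 2 + (j : ℝ))) /
      (((l.factorial : ℕ) : ℝ) * (((k - 2 * l).factorial : ℕ) : ℝ)) ≤
      ((k - l + 1 : ℕ) : ℝ) * ((k - l).choose l : ℝ) := by
    rw [div_le_iff₀ hden_pos]
    calc _ ≤ ((k - l + 1).factorial : ℝ) := hP
      _ = _ := hfact
  have hchoose : ((k - l).choose l : ℝ) ≤ 2 ^ k := by
    have h1 : (k - l).choose l ≤ 2 ^ (k - l) := Nat.choose_le_two_pow _ _
    have h2 : 2 ^ (k - l) ≤ 2 ^ k := Nat.pow_le_pow_right (by norm_num) (by omega)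
    exact_mod_cast h1.trans h2
  have hkl : ((k - l + 1 : ℕ) : ℝ) ≤ (k : ℝ) + 1 := by
    have : k - l + 1 ≤ k + 1 := by omega
    exact_mod_cast this
  have hpow : |2 * s| ^ (k - 2 * l) ≤ (2 : ℝ) ^ k := by
    have h2s : |2 * s| ≤ 2 := by rw [abs_mul, abs_two]; linarith
    calc |2 * s| ^ (k - 2 * l) ≤ (2 : ℝ) ^ (k - 2 * l) := pow_le_pow_left₀ (abs_nonneg _) h2s _
      _ ≤ 2 ^ k := pow_le_pow_right₀ (by norm_num) (by omega)
  have h4 : (4 : ℝ) ^ k = 2 ^ k * 2 ^ k := by rw [← mul_pow]; norm_num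
  calc _ ≤ (((k - l + 1 : ℕ) : ℝ) * ((k - l).choose l : ℝ)) * (2 : ℝ) ^ k :=
        mul_le_mul hquot hpow (by positivity) (by positivity)
    _ ≤ (((k : ℝ) + 1) * 2 ^ k) * 2 ^ k := by
        refine mul_le_mul_of_nonneg_right ?_ (by positivity)
        exact mul_le_mul hkl hchoose (by positivity) (by positivity)
    _ = ((k : ℝ) + 1) * 4 ^ k := by rw [h4]; ring

/-- **Exponential bound for the typed Gegenbauer polynomials**: `|C_k^{(3/2)}(s)| ≤ (k+1)² 4^k` for
`|s| ≤ 1` (the true growth is `C_k^{(3/2)}(1) = (k+1)(k+2)/2`; exponential is all that the heat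
weights `e^{-k(k+3)τ}`, `τ > 0`, need). [folklore] -/
theorem abs_gegen_le_sq_mul_four_pow (k : ℕ) {s : ℝ} (hs : |s| ≤ 1) :
    |gegen k s| ≤ ((k : ℝ) + 1) ^ 2 * 4 ^ k := by
  unfold gegen
  refine (Finset.abs_sum_le_sum_abs _ _).trans ?_
  have hterm : ∀ l ∈ Finset.range (k / 2 + 1),
      |(-1 : ℝ) ^ l * (∏ j ∈ Finset.range (k - l), ((3 : ℝ) / 2 + (j : ℝ))) /
        (((l.factorial : ℕ) : ℝ) * (((k - 2 * l).factorial : ℕ) : ℝ)) * (2 * s) ^ (k - 2 * l)|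
        ≤ ((k : ℝ) + 1) * 4 ^ k := by
    intro l hl
    have hl' := Finset.mem_range.1 hl
    exact abs_gegenTerm_le k l (by omega) hs
  refine (Finset.sum_le_sum hterm).trans ?_
  rw [Finset.sum_const, Finset.card_range, nsmul_eq_mul]
  have hk : ((k / 2 + 1 : ℕ) : ℝ) ≤ (k : ℝ) + 1 := by
    have : k / 2 + 1 ≤ k + 1 := by omega
    exact_mod_cast this
  have h0 : 0 ≤ ((k : ℝ) + 1) * 4 ^ k := by positivity
  calc ((k / 2 + 1 : ℕ) : ℝ) * (((k : ℝ) + 1) * 4 ^ k) ≤ ((k : ℝ) + 1) * (((k : ℝ) + 1) * 4 ^ k) :=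
        mul_le_mul_of_nonneg_right hk h0
    _ = ((k : ℝ) + 1) ^ 2 * 4 ^ k := by ring

/-- The polynomial factor of the weights is at most `8^k`: `(2k+3)/3 · (k+1)² ≤ (k+1)³ ≤ 8^k`.
[folklore] -/
theorem wtPoly_le_eight_pow (k : ℕ) : (2 * (k : ℝ) + 3) / 3 * ((k : ℝ) + 1) ^ 2 ≤ 8 ^ k := by
  have h1 : (k : ℝ) + 1 ≤ 2 ^ k := by
    induction k with
    | zero => norm_num
    | succ n ih =>
      have h1 : (1 : ℝ) ≤ 2 ^ n := one_le_pow₀ (by norm_num)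
      push_cast
      rw [pow_succ]
      linarith
  have h2 : (2 * (k : ℝ) + 3) / 3 ≤ (k : ℝ) + 1 := by
    rw [div_le_iff₀ (by norm_num : (0 : ℝ) < 3)]
    have : (0 : ℝ) ≤ k := k.cast_nonneg
    linarith
  have h3 : ((k : ℝ) + 1) ^ 3 ≤ (2 ^ k) ^ 3 := pow_le_pow_left₀ (by positivity) h1 3
  have h4 : ((2 : ℝ) ^ k) ^ 3 = 8 ^ k := by rw [← pow_mul, mul_comm, pow_mul]; norm_num
  calc (2 * (k : ℝ) + 3) / 3 * ((k : ℝ) + 1) ^ 2 ≤ ((k : ℝ) + 1) * ((k : ℝ) + 1) ^ 2 :=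
        mul_le_mul_of_nonneg_right h2 (by positivity)
    _ = ((k : ℝ) + 1) ^ 3 := by ring
    _ ≤ (2 ^ k) ^ 3 := h3
    _ = 8 ^ k := h4

/-! ### Summability at every positive scale -/

/-- The majorant is positive. [folklore] -/
theorem majorant_pos (τ : ℝ) (k : ℕ) : 0 < Real.exp (-((k : ℝ) * ((k : ℝ) + 3)) * τ) * 32 ^ k := by
  positivity

/-- The majorant is non-increasing in the scale. [folklore] -/
theorem majorant_antitone (k : ℕ) {τ₀ τ : ℝ} (h : τ₀ ≤ τ) :
    Real.exp (-((k : ℝ) * ((k : ℝ) + 3)) * τ) * 32 ^ k ≤ Real.exp (-((k : ℝ) * ((k : ℝ) + 3)) * τ₀) * 32 ^ k := by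
  refine mul_le_mul_of_nonneg_right (Real.exp_le_exp.2 ?_) (by positivity)
  have h0 : (0 : ℝ) ≤ (k : ℝ) * ((k : ℝ) + 3) := by positivity
  nlinarith

/-- **Term bound at every scale**: `|wt k τ · C_k(s)| ≤ e^{-k(k+3)τ} 32^k` for `|s| ≤ 1`. [folklore] -/
theorem abs_term_le_majorant (k : ℕ) (τ : ℝ) {s : ℝ} (hs : |s| ≤ 1) :
    |wt k τ * gegen k s| ≤ Real.exp (-((k : ℝ) * ((k : ℝ) + 3)) * τ) * 32 ^ k := by
  rw [abs_mul, abs_of_pos (wt_pos k τ), wt, mul_assoc]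
  refine mul_le_mul_of_nonneg_left ?_ (Real.exp_pos _).le
  calc (2 * (k : ℝ) + 3) / 3 * |gegen k s| ≤ (2 * (k : ℝ) + 3) / 3 * (((k : ℝ) + 1) ^ 2 * 4 ^ k) :=
        mul_le_mul_of_nonneg_left (abs_gegen_le_sq_mul_four_pow k hs) (by positivity)
    _ = ((2 * (k : ℝ) + 3) / 3 * ((k : ℝ) + 1) ^ 2) * 4 ^ k := by ring
    _ ≤ 8 ^ k * 4 ^ k := mul_le_mul_of_nonneg_right (wtPoly_le_eight_pow k) (by positivity)
    _ = 32 ^ k := by rw [← mul_pow]; norm_num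

/-- Term bound uniform on `[τ₀, ∞)`: `|wt k τ · C_k(s)| ≤ e^{-k(k+3)τ₀} 32^k` for `τ ≥ τ₀`, `|s| ≤ 1`.
[folklore] -/
theorem abs_term_le_majorant_of_le (k : ℕ) {τ₀ τ s : ℝ} (hτ : τ₀ ≤ τ) (hs : |s| ≤ 1) :
    |wt k τ * gegen k s| ≤ Real.exp (-((k : ℝ) * ((k : ℝ) + 3)) * τ₀) * 32 ^ k :=
  (abs_term_le_majorant k τ hs).trans (majorant_antitone k hτ)

/-- **The majorant is summable for every `τ > 0`**: for `k ≥ 63/τ`,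
`e^{(k+3)τ} ≥ (k+3)τ + 1 ≥ 64`, so `e^{-k(k+3)τ} 32^k = (32 e^{-(k+3)τ})^k ≤ 2^{-k}`. [folklore] -/
theorem summable_majorant {τ : ℝ} (hτ : 0 < τ) :
    Summable fun k : ℕ => Real.exp (-((k : ℝ) * ((k : ℝ) + 3)) * τ) * 32 ^ k := by
  refine Summable.of_norm_bounded_eventually_nat (g := fun k : ℕ => (1 / 2 : ℝ) ^ k)
    (summable_geometric_of_lt_one (by norm_num) (by norm_num)) ?_
  rw [Filter.eventually_atTop]
  refine ⟨⌈63 / τ⌉₊, fun k hk => ?_⟩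
  have hk' : 63 / τ ≤ (k : ℝ) := Nat.ceil_le.1 hk
  have hkτ : 63 ≤ (k : ℝ) * τ := by rwa [div_le_iff₀ hτ] at hk'
  rw [Real.norm_eq_abs, abs_of_pos (majorant_pos τ k)]
  have hexp : 64 ≤ Real.exp (((k : ℝ) + 3) * τ) := by
    have h := Real.add_one_le_exp (((k : ℝ) + 3) * τ)
    nlinarith
  have hsmall : Real.exp (-(((k : ℝ) + 3) * τ)) * 32 ≤ 1 / 2 := by
    rw [Real.exp_neg, inv_mul_le_iff₀ (Real.exp_pos _)]
    linarith
  have hrew : Real.exp (-((k : ℝ) * ((k : ℝ) + 3)) * τ) * 32 ^ k =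
      (Real.exp (-(((k : ℝ) + 3) * τ)) * 32) ^ k := by
    rw [mul_pow, ← Real.exp_nat_mul]
    congr 1
    congr 1
    ring
  rw [hrew]
  exact pow_le_pow_left₀ (by positivity) hsmall k

/-- **Summability of the typed series at every positive scale**: for `τ > 0` and `|s| ≤ 1` the series
`∑_k wt k τ · C_k^{(3/2)}(s)` defining `𝔥(τ, s)` converges absolutely (extends the tree's
`summable_term`, `τ ≥ 1`). [folklore] -/
theorem summable_term_of_pos {τ s : ℝ} (hτ : 0 < τ) (hs : |s| ≤ 1) :
    Summable fun k : ℕ => wt k τ * gegen k s := by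
  refine Summable.of_norm_bounded (summable_majorant hτ) fun k => ?_
  rw [Real.norm_eq_abs]
  exact abs_term_le_majorant k τ hs

/-- Absolute summability, spelled out. [folklore] -/
theorem summable_abs_term_of_pos {τ s : ℝ} (hτ : 0 < τ) (hs : |s| ≤ 1) :
    Summable fun k : ℕ => |wt k τ * gegen k s| :=
  (summable_term_of_pos hτ hs).abs

/-- The typed zonal kernel is the sum of its series at every positive scale. [folklore] -/
theorem hasSum_zonal {τ s : ℝ} (hτ : 0 < τ) (hs : |s| ≤ 1) :
    HasSum (fun k : ℕ => wt k τ * gegen k s) (zonal τ s) :=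
  (summable_term_of_pos hτ hs).hasSum

/-- **Uniform bound**: `|𝔥(τ, s)| ≤ ∑_k e^{-k(k+3)τ} 32^k` for `τ > 0`, `|s| ≤ 1`. [folklore] -/
theorem abs_zonal_le_majorant {τ s : ℝ} (hτ : 0 < τ) (hs : |s| ≤ 1) :
    |zonal τ s| ≤ ∑' k : ℕ, Real.exp (-((k : ℝ) * ((k : ℝ) + 3)) * τ) * 32 ^ k := by
  have h := tsum_of_norm_bounded (summable_majorant hτ).hasSum
    (fun k => by rw [Real.norm_eq_abs]; exact abs_term_le_majorant k τ hs)
  simpa [Real.norm_eq_abs, zonal] using h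

/-- Uniform bound on `[τ₀, ∞) × [-1, 1]`: `|𝔥(τ, s)| ≤ ∑_k e^{-k(k+3)τ₀} 32^k`. [folklore] -/
theorem abs_zonal_le_majorant_of_le {τ₀ τ s : ℝ} (hτ₀ : 0 < τ₀) (hτ : τ₀ ≤ τ) (hs : |s| ≤ 1) :
    |zonal τ s| ≤ ∑' k : ℕ, Real.exp (-((k : ℝ) * ((k : ℝ) + 3)) * τ₀) * 32 ^ k := by
  have h := tsum_of_norm_bounded (summable_majorant hτ₀).hasSum
    (fun k => by rw [Real.norm_eq_abs]; exact abs_term_le_majorant_of_le k hτ hs)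
  simpa [Real.norm_eq_abs, zonal] using h

/-- **The typed kernel is bounded on `N × N` at every fixed scale**, uniformly on `[τ₀, ∞)`:
`|K_{p,τ}(z)| ≤ ∑_k e^{-k(k+3)τ₀} 32^k` for `p, z ∈ N`, `τ ≥ τ₀ > 0` (Cauchy–Schwarz `|⟨z', p'⟩| ≤ 1`
and `e^{-(z₅-p₅)²/4τ} ≤ 1`). [folklore] -/
theorem abs_cylKernel_le_majorant {p z : EuclideanSpace ℝ (Fin 6)}
    (hp : ∑ i : Fin 5, p (Fin.castSucc i) ^ 2 = 1) (hz : ∑ i : Fin 5, z (Fin.castSucc i) ^ 2 = 1)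
    {τ₀ τ : ℝ} (hτ₀ : 0 < τ₀) (hτ : τ₀ ≤ τ) :
    |cylKernel p τ z| ≤ ∑' k : ℕ, Real.exp (-((k : ℝ) * ((k : ℝ) + 3)) * τ₀) * 32 ^ k := by
  rw [cylKernel_eq, abs_mul, abs_of_pos (Real.exp_pos _)]
  have h1 := abs_zonal_le_majorant_of_le hτ₀ hτ (abs_sum_mul_le_one hz hp)
  have h2 : Real.exp (-((z 5 - p 5) ^ 2) / (4 * τ)) ≤ 1 := by
    rw [Real.exp_le_one_iff, neg_div]
    exact neg_nonpos.2 (div_nonneg (sq_nonneg _) (by linarith))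
  calc |zonal τ (∑ i : Fin 5, z (Fin.castSucc i) * p (Fin.castSucc i))| *
        Real.exp (-((z 5 - p 5) ^ 2) / (4 * τ))
      ≤ (∑' k : ℕ, Real.exp (-((k : ℝ) * ((k : ℝ) + 3)) * τ₀) * 32 ^ k) * 1 :=
        mul_le_mul h1 h2 (Real.exp_pos _).le (tsum_nonneg fun k => (majorant_pos τ₀ k).le)
    _ = _ := mul_one _

/-! ### Continuity of the typed zonal kernel on `(0, ∞) × [-1, 1]` -/

/-- Each term `(τ, s) ↦ wt k τ · C_k(s)` is continuous. [folklore] -/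
theorem continuous_term (k : ℕ) : Continuous fun q : ℝ × ℝ => wt k q.1 * gegen k q.2 := by
  unfold wt gegen
  fun_prop

/-- **Joint continuity on `[τ₀, ∞) × [-1, 1]`** (`τ₀ > 0`): uniform convergence under the summable
majorant at `τ₀`. [folklore] -/
theorem continuousOn_zonal_prod_of_pos {τ₀ : ℝ} (hτ₀ : 0 < τ₀) :
    ContinuousOn (fun q : ℝ × ℝ => zonal q.1 q.2) (Set.Ici τ₀ ×ˢ Set.Icc (-1) 1) := by
  have h := continuousOn_tsum (f := fun (k : ℕ) (q : ℝ × ℝ) => wt k q.1 * gegen k q.2)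
    (s := Set.Ici τ₀ ×ˢ Set.Icc (-1) 1) (fun k => (continuous_term k).continuousOn)
    (summable_majorant hτ₀) (fun k q hq => by
      rw [Real.norm_eq_abs]
      exact abs_term_le_majorant_of_le k hq.1 (abs_le.2 ⟨by linarith [hq.2.1], hq.2.2⟩))
  simpa [zonal] using h

/-- **Joint continuity of the typed zonal kernel on `(0, ∞) × [-1, 1]`.** [folklore] -/
theorem continuousOn_zonal_prod :
    ContinuousOn (fun q : ℝ × ℝ => zonal q.1 q.2) (Set.Ioi 0 ×ˢ Set.Icc (-1) 1) := by
  intro q hq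
  have hτ : 0 < q.1 := hq.1
  have h2 : 0 < q.1 / 2 := by positivity
  have hmem : q ∈ Set.Ici (q.1 / 2) ×ˢ Set.Icc (-1 : ℝ) 1 := ⟨by simp only [Set.mem_Ici]; linarith, hq.2⟩
  have hc := continuousOn_zonal_prod_of_pos h2 q hmem
  refine hc.mono_of_mem_nhdsWithin ?_
  have hopen : Set.Ioi (q.1 / 2) ×ˢ (Set.univ : Set ℝ) ∈ 𝓝 q :=
    (isOpen_Ioi.prod isOpen_univ).mem_nhds ⟨by simp only [Set.mem_Ioi]; linarith, Set.mem_univ _⟩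
  filter_upwards [mem_nhdsWithin_of_mem_nhds hopen, self_mem_nhdsWithin] with r hr hr'
  exact ⟨Set.mem_Ici.2 (le_of_lt hr.1), hr'.2⟩

/-- Continuity in the angle variable at a fixed positive scale. [folklore] -/
theorem continuousOn_zonal {τ : ℝ} (hτ : 0 < τ) : ContinuousOn (zonal τ) (Set.Icc (-1) 1) := by
  have h := continuousOn_zonal_prod_of_pos hτ
  have hmap : ContinuousOn (fun s : ℝ => ((τ, s) : ℝ × ℝ)) (Set.Icc (-1) 1) := by fun_prop
  have hmaps : Set.MapsTo (fun s : ℝ => ((τ, s) : ℝ × ℝ)) (Set.Icc (-1) 1)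
      (Set.Ici τ ×ˢ Set.Icc (-1) 1) := fun s hs => ⟨Set.mem_Ici.2 le_rfl, hs⟩
  exact h.comp hmap hmaps

/-- Continuity in the scale variable on `(0, ∞)` at a fixed angle `|s| ≤ 1`. [folklore] -/
theorem continuousOn_zonal_left {s : ℝ} (hs : |s| ≤ 1) :
    ContinuousOn (fun τ : ℝ => zonal τ s) (Set.Ioi 0) := by
  have h := continuousOn_zonal_prod
  have hmap : ContinuousOn (fun τ : ℝ => ((τ, s) : ℝ × ℝ)) (Set.Ioi 0) := by fun_prop
  have hmaps : Set.MapsTo (fun τ : ℝ => ((τ, s) : ℝ × ℝ)) (Set.Ioi 0)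
      (Set.Ioi 0 ×ˢ Set.Icc (-1) 1) := fun τ hτ => ⟨hτ, abs_le.1 hs⟩
  exact h.comp hmap hmaps

end Literature.Geometry.Riemannian.SphericalCylinderEntropy

end
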